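import Summits.BirchSwinnertonDyer.BirchSwinnertonDyer.Theorems.GenusKolyvaginAtTwoGenusDeepSupplyAtTwoNegDiscNarrowOfKernels
import HarnessLib

/-!
# Route `GenusKolyvaginAtTwo`, crux 23491 `GenusDeepSupplyAtTwoNegDiscNarrow`: the deciding Δ<0 crux from FIVE ROUTE ITEMS + ONE beyond-print stub
# ON THE PRIME-FIELD FRAME (skeleton v6, LEAD gk2-p1 g22) — stub A‴ discharged, C⁗ split by Selmer cell into K₁′ ∧ K₄′

`--supports stmt-BirchSwinnertonDyer-23491 --as helper`.  THEOREMS ONLY.  **BSD is NOT proved by this file; no item is closed by it.**  CONDITIONAL on the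
displayed route items (Modularity 19382, 2-parity 23327, the declared 2-converse residuals 19220/24948, Gross–Zagier 24148) and the beyond-print stub.

WHY (LEAD decision of 2026-08-30 ≈08:30Z, STATUS; answer to gk2-p4 g26's design question (b)).  Stub A″'s tree proof
(`GenusKolyTwistingPrime.stub_minimalTwinSupplyAtTwo_genusBudget_one_of_twoConverse`, inside p760906 `stubA_narrow_of_items`) already produces a PRIME
Heegner field `K = ℚ(√−ℓ₀)`, `ℓ₀ ≡ 7 (8)` (so `d_K = −ℓ₀`, `2` split) — the components were discarded.  Skeleton v6 (crux workfile
`Cruxes/GenusDeepSupplyAtTwoNegDiscNarrow/Lines/genus_deep_supply_narrow.lean`, commit 71c3db321872, registered) makes them explicit in stub A‴'s output and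
hypotheses of the beyond-print stub C⁗; so the registered beyond-print content is asked ONLY on the frame where every kernel theorem of the line is
certified (depth zero: p761607/p762095, gk2-p5 p762214…p765790, gk2-p4 p763963…; positive depth: LEAD g22 p765489/p765896/p766296/p766389).

* §1 `stubA_prime_of_items` — **A‴ ⟸ Modularity ∧ 2-parity ∧ CONV₂ ∧ CONV₂′** (the same tree proof, components kept).
* §2 `genusDeepSupplyAtTwoNegDiscNarrow_of_kernels_prime` — GZ ∧ A‴ ∧ C⁗ ⟹ crux (g21's composition with the prime clauses threaded);
  **`genusDeepSupplyAtTwoNegDiscNarrow_of_items_of_stubC_prime`** — crux 23491 BY NAME ⟸ five route items ∧ C⁗.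
* §3 `stubC_prime_of_selmerSplit` — **C⁗ ⟸ K₁′ ∧ K₄′** (split by `#Sel₂(E) ∈ {1, 4}` on the prime frame; texts = binders `hK1`, `hK4` — THE ITEM TEXTS
  for the pen's R11 §5 itemisation), and `genusDeepSupplyAtTwoNegDiscNarrow_of_items_of_selmerSplit_prime` (crux ⟸ five items ∧ K₁′ ∧ K₄′).
  K₁′ is lossless (gk2-p5 p763825 restricted); K₄′ is the K₄ cell of the LEAD's structure files (`Ш(E_K)[2^∞] ≃ (ℤ/2^e)²`, witness at depth one).

References: [GrossZagier1986] Thm. I.6.3; [MazurRubin2010] Prop. 3.3, Cor. 3.4 (i); [GrossLMS1991] §3 (3.5), §4 (4.1), §11; [WZhang2014] Thm. 1.1.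
-/

set_option autoImplicit false
set_option linter.dupNamespace false -- `Summit.<P>.<Sub>` repeats `BirchSwinnertonDyer` (D-0017)

noncomputable section

open scoped Classical

namespace Summit.BirchSwinnertonDyer.BirchSwinnertonDyer.Theorems.GenusSupplyNarrow.PrimeFrame

open WeierstrassCurve Literature.NumberTheory.EllipticCurves Literature.NumberTheory.EllipticCurves.ModularForms
  Summit.BirchSwinnertonDyer.BirchSwinnertonDyer.Theses.GenusKolyvaginAtTwo
  Summit.BirchSwinnertonDyer.BirchSwinnertonDyer.Theorems.GenusKoly
  Summit.BirchSwinnertonDyer.BirchSwinnertonDyer.Theorems.GenusSupplyNarrow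

/-! ## §1 Stub A‴ from the route items -/

/-- **A‴ ⟸ Modularity ∧ 2-parity ∧ CONV₂ ∧ CONV₂′** — the registered v6 stub `stub_minimalTwinSupplyAtTwoNarrow` VERBATIM: the narrow-Selmer minimal
twin supply on Δ<0 WITH the prime-field clauses (`∃ ℓ₀ prime, d_K = −ℓ₀`; `2` split in `K`).  Same proof as p760906 `stubA_narrow_of_items`
(gk2-p5 g20's prime-Heegner-field supply `ℓ₀ ≡ 7 (8)`), keeping the components.  CONDITIONAL on the four items.
[cite: MazurRubin2010, Prop. 3.3, Cor. 3.4 (i)] [cite: Kramer1981, §2 Prop. 3] [cite: DokchitserDokchitserAnnals2010, Thm. 1.4] -/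
theorem stubA_prime_of_items (hmod : ModularityExistsNewform) (hpar : TwoParityDD) (hconv : RankOneTwoConverse)
    (hconv' : RankOneTwoConverseOffSemistableAtTwo) :
    ∀ (W : WeierstrassCurve ℚ) [W.IsElliptic] [W.IsGloballyMinimal] [NeZero (W.conductorNorm ℤ)],
    ¬ W.HasCM → W.analyticRank = 0 → (∀ n : ℕ, 0 < n → W.HasSurjectiveModNGaloisRep ((2 : ℤ) ^ n)) →
    Odd W.tamagawaProduct → W.Δ < 0 → (Nat.card (W.selmerGroup 2) = 1 ∨ Nat.card (W.selmerGroup 2) = 4) →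
    ∃ (K : Type) (_ : Field K) (_ : NumberField K),
    IsImaginaryQuadratic K ∧ Odd (NumberField.discr K) ∧ NumberField.discr K ≠ -3 ∧
    SatisfiesHeegnerHypothesis (W.conductorNorm ℤ) K ∧
    ¬ IsSquare ((NumberField.discr K : ℚ) * -|W.Δ|) ∧ ¬ IsSquare ((NumberField.discr K : ℚ) * (-(2 * |W.Δ|))) ∧
    (∃ ℓ₀ : ℕ, ℓ₀.Prime ∧ NumberField.discr K = -(ℓ₀ : ℤ)) ∧
    ((Ideal.span {(2 : ℤ)}).primesOver (NumberField.RingOfIntegers K)).ncard = 2 ∧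
    ∃ (Wd : WeierstrassCurve ℚ) (_ : Wd.IsElliptic) (_ : Wd.IsGloballyMinimal),
    (∃ C : WeierstrassCurve.VariableChange ℚ, C • W.quadraticTwist (NumberField.discr K : ℚ) = Wd) ∧
    Wd.analyticRank = 1 ∧ Nat.card (Wd.selmerGroup 2) = 2 ∧ padicValNat 2 Wd.tamagawaProduct ≤ 1 := by
  intro W _ _ _ hcm hr0 hρ hT hneg h14
  have hc : ∀ (V : WeierstrassCurve ℚ) [V.IsElliptic] [V.IsGloballyMinimal],
      ¬ V.HasCM → V.selmerCorank 2 = 1 → V.analyticRank = 1 := fun V _ _ hV hco ↦ by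
    by_cases h : (Rank1Residual.GoodOrd V 2 ∨ Rank1Residual.Mult V 2)
    · exact hconv V hV h hco
    · exact hconv' V hV h hco
  obtain ⟨ℓ, hℓ, -, -, K, iF, iN, hIQ, hd, hodd, h3, hHe, hsq1, hsq2, h2K, Wd, iE, iM, hWd, -, hrd, hSel, hB⟩ :=
    GenusKolyTwistingPrime.stub_minimalTwinSupplyAtTwo_genusBudget_one_of_twoConverse hmod hpar hc W hcm hr0 hρ hneg hT h14
  exact ⟨K, iF, iN, hIQ, hodd, h3, hHe, hsq1, hsq2, ⟨ℓ, hℓ, hd⟩, h2K, Wd, iE, iM, hWd, hrd, hSel, hB.le⟩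

/-! ## §2 The crux from GZ ∧ A‴ ∧ C⁗, and from the five items ∧ C⁗ -/

/-- **`GrossZagierAllLevels → A‴ → C⁗ → GenusDeepSupplyAtTwoNegDiscNarrow`** — the v6 composition, sorry-free outside its displayed hypotheses
(g21's `genusDeepSupplyAtTwoNegDiscNarrow_of_kernels` with the prime-field clauses threaded from A‴ into C⁗; depth zero closed by `n = 1`).
[cite: GrossZagier1986, Thm. I.6.3 with V.§2] [cite: GrossLMS1991, §3 (3.5), §4 (4.1)] -/
theorem genusDeepSupplyAtTwoNegDiscNarrow_of_kernels_prime (hGZ : GrossZagierAllLevels)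
    (hA : ∀ (W : WeierstrassCurve ℚ) [W.IsElliptic] [W.IsGloballyMinimal] [NeZero (W.conductorNorm ℤ)],
      ¬ W.HasCM → W.analyticRank = 0 → (∀ n : ℕ, 0 < n → W.HasSurjectiveModNGaloisRep ((2 : ℤ) ^ n)) →
      Odd W.tamagawaProduct → W.Δ < 0 → (Nat.card (W.selmerGroup 2) = 1 ∨ Nat.card (W.selmerGroup 2) = 4) →
      ∃ (K : Type) (_ : Field K) (_ : NumberField K),
      IsImaginaryQuadratic K ∧ Odd (NumberField.discr K) ∧ NumberField.discr K ≠ -3 ∧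
      SatisfiesHeegnerHypothesis (W.conductorNorm ℤ) K ∧
      ¬ IsSquare ((NumberField.discr K : ℚ) * -|W.Δ|) ∧ ¬ IsSquare ((NumberField.discr K : ℚ) * (-(2 * |W.Δ|))) ∧
      (∃ ℓ₀ : ℕ, ℓ₀.Prime ∧ NumberField.discr K = -(ℓ₀ : ℤ)) ∧
      ((Ideal.span {(2 : ℤ)}).primesOver (NumberField.RingOfIntegers K)).ncard = 2 ∧
      ∃ (Wd : WeierstrassCurve ℚ) (_ : Wd.IsElliptic) (_ : Wd.IsGloballyMinimal),
      (∃ C : WeierstrassCurve.VariableChange ℚ, C • W.quadraticTwist (NumberField.discr K : ℚ) = Wd) ∧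
      Wd.analyticRank = 1 ∧ Nat.card (Wd.selmerGroup 2) = 2 ∧ padicValNat 2 Wd.tamagawaProduct ≤ 1)
    (hC : ∀ (W : WeierstrassCurve ℚ) [W.IsElliptic] [W.IsGloballyMinimal] [NeZero (W.conductorNorm ℤ)],
      ¬ W.HasCM → W.analyticRank = 0 → (∀ n : ℕ, 0 < n → W.HasSurjectiveModNGaloisRep ((2 : ℤ) ^ n)) →
      Odd W.tamagawaProduct → W.Δ < 0 → (Nat.card (W.selmerGroup 2) = 1 ∨ Nat.card (W.selmerGroup 2) = 4) →
      ∀ (K : Type) [Field K] [NumberField K],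
      IsImaginaryQuadratic K → Odd (NumberField.discr K) → NumberField.discr K ≠ -3 →
      SatisfiesHeegnerHypothesis (W.conductorNorm ℤ) K →
      ¬ IsSquare ((NumberField.discr K : ℚ) * -|W.Δ|) → ¬ IsSquare ((NumberField.discr K : ℚ) * (-(2 * |W.Δ|))) →
      ∀ (ℓ₀ : ℕ), ℓ₀.Prime → NumberField.discr K = -(ℓ₀ : ℤ) →
      ((Ideal.span {(2 : ℤ)}).primesOver (NumberField.RingOfIntegers K)).ncard = 2 →
      ∀ (Dt : ModularParametrizationData W (W.conductorNorm ℤ)),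
      (∀ z ∈ Dt.L.lattice, ∃ w ∈ periodLattice Dt.f, z = (Dt.c : ℂ) * w) → Odd Dt.c →
      ∀ (β : ℤ) (ι : K →+* ℂ) (d₁ : KolyvaginHeegnerData Dt β ι 1), ¬ IsOfFinAddOrder d₁.derivedPoint →
      ∀ (M₀ : ℕ), (∃ Q : (W.baseChange (ringClassField K ι 1)).toAffine.Point, ((2 ^ M₀ : ℕ) : ℤ) • Q = d₁.derivedPoint) →
      (¬ ∃ Q : (W.baseChange (ringClassField K ι 1)).toAffine.Point, ((2 ^ (M₀ + 1) : ℕ) : ℤ) • Q = d₁.derivedPoint) →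
      1 ≤ M₀ →
      ∀ (Wd : WeierstrassCurve ℚ) [Wd.IsElliptic] [Wd.IsGloballyMinimal],
      (∃ C : WeierstrassCurve.VariableChange ℚ, C • W.quadraticTwist (NumberField.discr K : ℚ) = Wd) →
      Wd.analyticRank = 1 → Nat.card (Wd.selmerGroup 2) = 2 → padicValNat 2 Wd.tamagawaProduct ≤ 1 →
      ∃ (n : ℕ) (d : KolyvaginHeegnerData Dt β ι n), Squarefree n ∧
      (∀ ℓ ∈ n.primeFactors, Zhang2014.IsKolyvaginPrime (W.conductorNorm ℤ) W K 2 ℓ ∧ 2 ≤ Zhang2014.kolyvaginIndex W 2 ℓ ∧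
      FrobEqFrobInfty W K 2 ℓ) ∧
      ¬ ∃ Q : (W.baseChange (ringClassField K ι n)).toAffine.Point, (2 : ℤ) • Q = d.derivedPoint) :
    GenusDeepSupplyAtTwoNegDiscNarrow := by
  intro W _ _ _ hcm hr0 hρ hT hneg hopt h14
  -- A″: the field and the narrow twin
  obtain ⟨K, iF, iN, hIQ, hodd, h3, hHe, hsq1, hsq2, ⟨ℓ₀, hℓ₀, hdK⟩, h2K, Wd, iE, iM, hWd, hrd, hSel, hDEF⟩ := hA W hcm hr0 hρ hT hneg h14
  obtain ⟨Dt, hoptDt, hc⟩ := hopt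
  -- glue: orientation, embedding, conductor-`1` datum
  obtain ⟨β, hβ⟩ : ∃ β : ℤ, (4 * (W.conductorNorm ℤ : ℕ) : ℤ) ∣ β ^ 2 - NumberField.discr K :=
    Literature.NumberTheory.QuadraticFields.Quadratic.exists_dvd_sq_sub_discr_of_ncard_primesOver hIQ.1 (NeZero.ne _) hHe
  obtain ⟨ι⟩ : Nonempty (K →+* ℂ) := inferInstance
  obtain ⟨d₁⟩ := exists_kolyvaginHeegnerData_one
    (phi_heegnerTau_mem_singularModuliField_holds (W.conductorNorm ℤ) W K) hIQ Dt β ι hβ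
  -- the twin: non-CM; the analytic rank of the twist is read off its minimal model
  have hd : (NumberField.discr K : ℚ) ≠ 0 := by exact_mod_cast NumberField.discr_ne_zero K
  haveI := W.isElliptic_quadraticTwist hd
  have hcmd : ¬ Wd.HasCM := twin_not_hasCM W hcm hd Wd hWd
  have hrtw : (W.quadraticTwist (NumberField.discr K : ℚ)).analyticRank = 1 := by
    obtain ⟨C, hC⟩ := hWd
    rw [← analyticRank_smul (W.quadraticTwist (NumberField.discr K : ℚ)) C, hC]
    exact hrd
  -- B from Gross–Zagier at the pair `(E, K)`, level `N_E`
  have hy : ¬ IsOfFinAddOrder d₁.derivedPoint :=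
    stub_heegnerNonTorsionAtTwo_pair_of_grossZagier W K (hGZ (W.conductorNorm ℤ) W K) hIQ hHe hr0 hrtw Dt β ι d₁
  -- McCallum's exponent
  obtain ⟨M₀, hdiv, hndiv⟩ := exists_exactTwoDivisibility_of_not_isOfFinAddOrder W hIQ Dt β ι d₁ hy
  -- the deep witness: free at depth `0`, C‴ at positive depth
  obtain ⟨n, d, hn, hKoly, hPn⟩ : ∃ (n : ℕ) (d : KolyvaginHeegnerData Dt β ι n), Squarefree n ∧
      (∀ ℓ ∈ n.primeFactors, Zhang2014.IsKolyvaginPrime (W.conductorNorm ℤ) W K 2 ℓ ∧ 2 ≤ Zhang2014.kolyvaginIndex W 2 ℓ ∧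
        FrobEqFrobInfty W K 2 ℓ) ∧
      ¬ ∃ Q : (W.baseChange (ringClassField K ι n)).toAffine.Point, (2 : ℤ) • Q = d.derivedPoint := by
    rcases Nat.eq_zero_or_pos M₀ with hM | hM
    · subst hM
      exact exists_deepWitness_of_depth_zero W Dt β ι d₁ _ hndiv
    · exact hC W hcm hr0 hρ hT hneg h14 K hIQ hodd h3 hHe hsq1 hsq2 ℓ₀ hℓ₀ hdK h2K Dt hoptDt hc β ι d₁ hy M₀ hdiv hndiv hM
        Wd hWd hrd hSel hDEF
  exact ⟨K, iF, iN, hIQ, hodd, h3, hHe, hsq1, hsq2, Dt, β, ι, d₁, hoptDt, hc, hy, M₀, hdiv, hndiv, n, d, hn, hKoly, hPn,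
    Wd, iE, iM, hWd, hcmd, hrd, hSel, hDEF⟩

/-! ## §3 The registered stub C implies its reshaped form C‴ -/

/-- **THE DECIDING Δ<0 CRUX BY NAME FROM FIVE ROUTE ITEMS AND THE PRIME-FRAME STUB C⁗.**  CONDITIONAL.  BSD is NOT proved by this.
[cite: GrossZagier1986, Thm. I.6.3 with V.§2] [cite: MazurRubin2010, Prop. 3.3, Cor. 3.4 (i)] [cite: GrossLMS1991, §3 (3.5), §4 (4.1)] -/
theorem genusDeepSupplyAtTwoNegDiscNarrow_of_items_of_stubC_prime (hGZ : GrossZagierAllLevels) (hmod : ModularityExistsNewform)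
    (hpar : TwoParityDD) (hconv : RankOneTwoConverse) (hconv' : RankOneTwoConverseOffSemistableAtTwo)
    (hC : ∀ (W : WeierstrassCurve ℚ) [W.IsElliptic] [W.IsGloballyMinimal] [NeZero (W.conductorNorm ℤ)],
      ¬ W.HasCM → W.analyticRank = 0 → (∀ n : ℕ, 0 < n → W.HasSurjectiveModNGaloisRep ((2 : ℤ) ^ n)) →
      Odd W.tamagawaProduct → W.Δ < 0 → (Nat.card (W.selmerGroup 2) = 1 ∨ Nat.card (W.selmerGroup 2) = 4) →
      ∀ (K : Type) [Field K] [NumberField K],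
      IsImaginaryQuadratic K → Odd (NumberField.discr K) → NumberField.discr K ≠ -3 →
      SatisfiesHeegnerHypothesis (W.conductorNorm ℤ) K →
      ¬ IsSquare ((NumberField.discr K : ℚ) * -|W.Δ|) → ¬ IsSquare ((NumberField.discr K : ℚ) * (-(2 * |W.Δ|))) →
      ∀ (ℓ₀ : ℕ), ℓ₀.Prime → NumberField.discr K = -(ℓ₀ : ℤ) →
      ((Ideal.span {(2 : ℤ)}).primesOver (NumberField.RingOfIntegers K)).ncard = 2 →
      ∀ (Dt : ModularParametrizationData W (W.conductorNorm ℤ)),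
      (∀ z ∈ Dt.L.lattice, ∃ w ∈ periodLattice Dt.f, z = (Dt.c : ℂ) * w) → Odd Dt.c →
      ∀ (β : ℤ) (ι : K →+* ℂ) (d₁ : KolyvaginHeegnerData Dt β ι 1), ¬ IsOfFinAddOrder d₁.derivedPoint →
      ∀ (M₀ : ℕ), (∃ Q : (W.baseChange (ringClassField K ι 1)).toAffine.Point, ((2 ^ M₀ : ℕ) : ℤ) • Q = d₁.derivedPoint) →
      (¬ ∃ Q : (W.baseChange (ringClassField K ι 1)).toAffine.Point, ((2 ^ (M₀ + 1) : ℕ) : ℤ) • Q = d₁.derivedPoint) →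
      1 ≤ M₀ →
      ∀ (Wd : WeierstrassCurve ℚ) [Wd.IsElliptic] [Wd.IsGloballyMinimal],
      (∃ C : WeierstrassCurve.VariableChange ℚ, C • W.quadraticTwist (NumberField.discr K : ℚ) = Wd) →
      Wd.analyticRank = 1 → Nat.card (Wd.selmerGroup 2) = 2 → padicValNat 2 Wd.tamagawaProduct ≤ 1 →
      ∃ (n : ℕ) (d : KolyvaginHeegnerData Dt β ι n), Squarefree n ∧
      (∀ ℓ ∈ n.primeFactors, Zhang2014.IsKolyvaginPrime (W.conductorNorm ℤ) W K 2 ℓ ∧ 2 ≤ Zhang2014.kolyvaginIndex W 2 ℓ ∧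
      FrobEqFrobInfty W K 2 ℓ) ∧
      ¬ ∃ Q : (W.baseChange (ringClassField K ι n)).toAffine.Point, (2 : ℤ) • Q = d.derivedPoint) :
    GenusDeepSupplyAtTwoNegDiscNarrow :=
  genusDeepSupplyAtTwoNegDiscNarrow_of_kernels_prime hGZ (stubA_prime_of_items hmod hpar hconv hconv') hC

/-! ## §3 C⁗ split by the Selmer cell on the prime frame: K₁′ ∧ K₄′ — THE ITEM TEXTS -/

/-- **C⁗ ⟸ K₁′ ∧ K₄′.**  K₁′ (`hK1`): on `#Sel₂(E) = 1` the C⁗-frame with `1 ≤ M₀` is contradictory (depth zero; LOSSLESS — follows from the leaf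
modulo PRINT, gk2-p5 p763825).  K₄′ (`hK4`): C⁗ on `#Sel₂(E) = 4` — THE beyond-print kernel (Kolyvagin's conjecture `𝓜_∞ = 0` at `2` with
level-2 primes, prime Heegner field; the K₄ cell of `…KFourCellShaTwoRank` / `…KFourCellShaStructure` / `…KFourCellInvariantClasses`).  Pure logic.
[cite: GrossLMS1991, §4 (4.1), §11] -/
theorem stubC_prime_of_selmerSplit
    (hK1 : ∀ (W : WeierstrassCurve ℚ) [W.IsElliptic] [W.IsGloballyMinimal] [NeZero (W.conductorNorm ℤ)],
      ¬ W.HasCM → W.analyticRank = 0 → (∀ n : ℕ, 0 < n → W.HasSurjectiveModNGaloisRep ((2 : ℤ) ^ n)) →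
      Odd W.tamagawaProduct → W.Δ < 0 → Nat.card (W.selmerGroup 2) = 1 →
      ∀ (K : Type) [Field K] [NumberField K],
      IsImaginaryQuadratic K → Odd (NumberField.discr K) → NumberField.discr K ≠ -3 →
      SatisfiesHeegnerHypothesis (W.conductorNorm ℤ) K →
      ¬ IsSquare ((NumberField.discr K : ℚ) * -|W.Δ|) → ¬ IsSquare ((NumberField.discr K : ℚ) * (-(2 * |W.Δ|))) →
      ∀ (ℓ₀ : ℕ), ℓ₀.Prime → NumberField.discr K = -(ℓ₀ : ℤ) →
      ((Ideal.span {(2 : ℤ)}).primesOver (NumberField.RingOfIntegers K)).ncard = 2 →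
      ∀ (Dt : ModularParametrizationData W (W.conductorNorm ℤ)),
      (∀ z ∈ Dt.L.lattice, ∃ w ∈ periodLattice Dt.f, z = (Dt.c : ℂ) * w) → Odd Dt.c →
      ∀ (β : ℤ) (ι : K →+* ℂ) (d₁ : KolyvaginHeegnerData Dt β ι 1), ¬ IsOfFinAddOrder d₁.derivedPoint →
      ∀ (M₀ : ℕ), (∃ Q : (W.baseChange (ringClassField K ι 1)).toAffine.Point, ((2 ^ M₀ : ℕ) : ℤ) • Q = d₁.derivedPoint) →
      (¬ ∃ Q : (W.baseChange (ringClassField K ι 1)).toAffine.Point, ((2 ^ (M₀ + 1) : ℕ) : ℤ) • Q = d₁.derivedPoint) →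
      1 ≤ M₀ →
      ∀ (Wd : WeierstrassCurve ℚ) [Wd.IsElliptic] [Wd.IsGloballyMinimal],
      (∃ C : WeierstrassCurve.VariableChange ℚ, C • W.quadraticTwist (NumberField.discr K : ℚ) = Wd) →
      Wd.analyticRank = 1 → Nat.card (Wd.selmerGroup 2) = 2 → padicValNat 2 Wd.tamagawaProduct ≤ 1 →
      False)
    (hK4 : ∀ (W : WeierstrassCurve ℚ) [W.IsElliptic] [W.IsGloballyMinimal] [NeZero (W.conductorNorm ℤ)],
      ¬ W.HasCM → W.analyticRank = 0 → (∀ n : ℕ, 0 < n → W.HasSurjectiveModNGaloisRep ((2 : ℤ) ^ n)) →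
      Odd W.tamagawaProduct → W.Δ < 0 → Nat.card (W.selmerGroup 2) = 4 →
      ∀ (K : Type) [Field K] [NumberField K],
      IsImaginaryQuadratic K → Odd (NumberField.discr K) → NumberField.discr K ≠ -3 →
      SatisfiesHeegnerHypothesis (W.conductorNorm ℤ) K →
      ¬ IsSquare ((NumberField.discr K : ℚ) * -|W.Δ|) → ¬ IsSquare ((NumberField.discr K : ℚ) * (-(2 * |W.Δ|))) →
      ∀ (ℓ₀ : ℕ), ℓ₀.Prime → NumberField.discr K = -(ℓ₀ : ℤ) →
      ((Ideal.span {(2 : ℤ)}).primesOver (NumberField.RingOfIntegers K)).ncard = 2 →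
      ∀ (Dt : ModularParametrizationData W (W.conductorNorm ℤ)),
      (∀ z ∈ Dt.L.lattice, ∃ w ∈ periodLattice Dt.f, z = (Dt.c : ℂ) * w) → Odd Dt.c →
      ∀ (β : ℤ) (ι : K →+* ℂ) (d₁ : KolyvaginHeegnerData Dt β ι 1), ¬ IsOfFinAddOrder d₁.derivedPoint →
      ∀ (M₀ : ℕ), (∃ Q : (W.baseChange (ringClassField K ι 1)).toAffine.Point, ((2 ^ M₀ : ℕ) : ℤ) • Q = d₁.derivedPoint) →
      (¬ ∃ Q : (W.baseChange (ringClassField K ι 1)).toAffine.Point, ((2 ^ (M₀ + 1) : ℕ) : ℤ) • Q = d₁.derivedPoint) →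
      1 ≤ M₀ →
      ∀ (Wd : WeierstrassCurve ℚ) [Wd.IsElliptic] [Wd.IsGloballyMinimal],
      (∃ C : WeierstrassCurve.VariableChange ℚ, C • W.quadraticTwist (NumberField.discr K : ℚ) = Wd) →
      Wd.analyticRank = 1 → Nat.card (Wd.selmerGroup 2) = 2 → padicValNat 2 Wd.tamagawaProduct ≤ 1 →
      ∃ (n : ℕ) (d : KolyvaginHeegnerData Dt β ι n), Squarefree n ∧
      (∀ ℓ ∈ n.primeFactors, Zhang2014.IsKolyvaginPrime (W.conductorNorm ℤ) W K 2 ℓ ∧ 2 ≤ Zhang2014.kolyvaginIndex W 2 ℓ ∧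
      FrobEqFrobInfty W K 2 ℓ) ∧
      ¬ ∃ Q : (W.baseChange (ringClassField K ι n)).toAffine.Point, (2 : ℤ) • Q = d.derivedPoint) :
    ∀ (W : WeierstrassCurve ℚ) [W.IsElliptic] [W.IsGloballyMinimal] [NeZero (W.conductorNorm ℤ)],
    ¬ W.HasCM → W.analyticRank = 0 → (∀ n : ℕ, 0 < n → W.HasSurjectiveModNGaloisRep ((2 : ℤ) ^ n)) →
    Odd W.tamagawaProduct → W.Δ < 0 → (Nat.card (W.selmerGroup 2) = 1 ∨ Nat.card (W.selmerGroup 2) = 4) →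
    ∀ (K : Type) [Field K] [NumberField K],
    IsImaginaryQuadratic K → Odd (NumberField.discr K) → NumberField.discr K ≠ -3 →
    SatisfiesHeegnerHypothesis (W.conductorNorm ℤ) K →
    ¬ IsSquare ((NumberField.discr K : ℚ) * -|W.Δ|) → ¬ IsSquare ((NumberField.discr K : ℚ) * (-(2 * |W.Δ|))) →
    ∀ (ℓ₀ : ℕ), ℓ₀.Prime → NumberField.discr K = -(ℓ₀ : ℤ) →
    ((Ideal.span {(2 : ℤ)}).primesOver (NumberField.RingOfIntegers K)).ncard = 2 →
    ∀ (Dt : ModularParametrizationData W (W.conductorNorm ℤ)),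
    (∀ z ∈ Dt.L.lattice, ∃ w ∈ periodLattice Dt.f, z = (Dt.c : ℂ) * w) → Odd Dt.c →
    ∀ (β : ℤ) (ι : K →+* ℂ) (d₁ : KolyvaginHeegnerData Dt β ι 1), ¬ IsOfFinAddOrder d₁.derivedPoint →
    ∀ (M₀ : ℕ), (∃ Q : (W.baseChange (ringClassField K ι 1)).toAffine.Point, ((2 ^ M₀ : ℕ) : ℤ) • Q = d₁.derivedPoint) →
    (¬ ∃ Q : (W.baseChange (ringClassField K ι 1)).toAffine.Point, ((2 ^ (M₀ + 1) : ℕ) : ℤ) • Q = d₁.derivedPoint) →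
    1 ≤ M₀ →
    ∀ (Wd : WeierstrassCurve ℚ) [Wd.IsElliptic] [Wd.IsGloballyMinimal],
    (∃ C : WeierstrassCurve.VariableChange ℚ, C • W.quadraticTwist (NumberField.discr K : ℚ) = Wd) →
    Wd.analyticRank = 1 → Nat.card (Wd.selmerGroup 2) = 2 → padicValNat 2 Wd.tamagawaProduct ≤ 1 →
    ∃ (n : ℕ) (d : KolyvaginHeegnerData Dt β ι n), Squarefree n ∧
    (∀ ℓ ∈ n.primeFactors, Zhang2014.IsKolyvaginPrime (W.conductorNorm ℤ) W K 2 ℓ ∧ 2 ≤ Zhang2014.kolyvaginIndex W 2 ℓ ∧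
    FrobEqFrobInfty W K 2 ℓ) ∧
    ¬ ∃ Q : (W.baseChange (ringClassField K ι n)).toAffine.Point, (2 : ℤ) • Q = d.derivedPoint := by
  intro W _ _ _ hcm hr0 hρ hT hneg h14 K _ _ hIQ hodd h3 hHe hsq1 hsq2 ℓ₀ hℓ₀ hdK h2K Dt hoptDt hc β ι d₁ hy M₀ hdiv hndiv hM
    Wd _ _ hWd hrd hSel hDEF
  rcases h14 with h1 | h4
  · exact (hK1 W hcm hr0 hρ hT hneg h1 K hIQ hodd h3 hHe hsq1 hsq2 ℓ₀ hℓ₀ hdK h2K Dt hoptDt hc β ι d₁ hy M₀ hdiv hndiv hM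
      Wd hWd hrd hSel hDEF).elim
  · exact hK4 W hcm hr0 hρ hT hneg h4 K hIQ hodd h3 hHe hsq1 hsq2 ℓ₀ hℓ₀ hdK h2K Dt hoptDt hc β ι d₁ hy M₀ hdiv hndiv hM Wd hWd hrd hSel hDEF

/-- **THE DECIDING Δ<0 CRUX FROM FIVE ROUTE ITEMS + K₁′ + K₄′ (prime frame).**  The one-line closer of the pen's glue item once K₁′/K₄′ are itemised
with THESE texts.  CONDITIONAL.  BSD is NOT proved by this.  [cite: GrossLMS1991, §4 (4.1), §11] [cite: MazurRubin2010, Prop. 3.3] -/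
theorem genusDeepSupplyAtTwoNegDiscNarrow_of_items_of_selmerSplit_prime (hGZ : GrossZagierAllLevels) (hmod : ModularityExistsNewform)
    (hpar : TwoParityDD) (hconv : RankOneTwoConverse) (hconv' : RankOneTwoConverseOffSemistableAtTwo)
    (hK1 : ∀ (W : WeierstrassCurve ℚ) [W.IsElliptic] [W.IsGloballyMinimal] [NeZero (W.conductorNorm ℤ)],
      ¬ W.HasCM → W.analyticRank = 0 → (∀ n : ℕ, 0 < n → W.HasSurjectiveModNGaloisRep ((2 : ℤ) ^ n)) →
      Odd W.tamagawaProduct → W.Δ < 0 → Nat.card (W.selmerGroup 2) = 1 →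
      ∀ (K : Type) [Field K] [NumberField K],
      IsImaginaryQuadratic K → Odd (NumberField.discr K) → NumberField.discr K ≠ -3 →
      SatisfiesHeegnerHypothesis (W.conductorNorm ℤ) K →
      ¬ IsSquare ((NumberField.discr K : ℚ) * -|W.Δ|) → ¬ IsSquare ((NumberField.discr K : ℚ) * (-(2 * |W.Δ|))) →
      ∀ (ℓ₀ : ℕ), ℓ₀.Prime → NumberField.discr K = -(ℓ₀ : ℤ) →
      ((Ideal.span {(2 : ℤ)}).primesOver (NumberField.RingOfIntegers K)).ncard = 2 →
      ∀ (Dt : ModularParametrizationData W (W.conductorNorm ℤ)),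
      (∀ z ∈ Dt.L.lattice, ∃ w ∈ periodLattice Dt.f, z = (Dt.c : ℂ) * w) → Odd Dt.c →
      ∀ (β : ℤ) (ι : K →+* ℂ) (d₁ : KolyvaginHeegnerData Dt β ι 1), ¬ IsOfFinAddOrder d₁.derivedPoint →
      ∀ (M₀ : ℕ), (∃ Q : (W.baseChange (ringClassField K ι 1)).toAffine.Point, ((2 ^ M₀ : ℕ) : ℤ) • Q = d₁.derivedPoint) →
      (¬ ∃ Q : (W.baseChange (ringClassField K ι 1)).toAffine.Point, ((2 ^ (M₀ + 1) : ℕ) : ℤ) • Q = d₁.derivedPoint) →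
      1 ≤ M₀ →
      ∀ (Wd : WeierstrassCurve ℚ) [Wd.IsElliptic] [Wd.IsGloballyMinimal],
      (∃ C : WeierstrassCurve.VariableChange ℚ, C • W.quadraticTwist (NumberField.discr K : ℚ) = Wd) →
      Wd.analyticRank = 1 → Nat.card (Wd.selmerGroup 2) = 2 → padicValNat 2 Wd.tamagawaProduct ≤ 1 →
      False)
    (hK4 : ∀ (W : WeierstrassCurve ℚ) [W.IsElliptic] [W.IsGloballyMinimal] [NeZero (W.conductorNorm ℤ)],
      ¬ W.HasCM → W.analyticRank = 0 → (∀ n : ℕ, 0 < n → W.HasSurjectiveModNGaloisRep ((2 : ℤ) ^ n)) →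
      Odd W.tamagawaProduct → W.Δ < 0 → Nat.card (W.selmerGroup 2) = 4 →
      ∀ (K : Type) [Field K] [NumberField K],
      IsImaginaryQuadratic K → Odd (NumberField.discr K) → NumberField.discr K ≠ -3 →
      SatisfiesHeegnerHypothesis (W.conductorNorm ℤ) K →
      ¬ IsSquare ((NumberField.discr K : ℚ) * -|W.Δ|) → ¬ IsSquare ((NumberField.discr K : ℚ) * (-(2 * |W.Δ|))) →
      ∀ (ℓ₀ : ℕ), ℓ₀.Prime → NumberField.discr K = -(ℓ₀ : ℤ) →
      ((Ideal.span {(2 : ℤ)}).primesOver (NumberField.RingOfIntegers K)).ncard = 2 →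
      ∀ (Dt : ModularParametrizationData W (W.conductorNorm ℤ)),
      (∀ z ∈ Dt.L.lattice, ∃ w ∈ periodLattice Dt.f, z = (Dt.c : ℂ) * w) → Odd Dt.c →
      ∀ (β : ℤ) (ι : K →+* ℂ) (d₁ : KolyvaginHeegnerData Dt β ι 1), ¬ IsOfFinAddOrder d₁.derivedPoint →
      ∀ (M₀ : ℕ), (∃ Q : (W.baseChange (ringClassField K ι 1)).toAffine.Point, ((2 ^ M₀ : ℕ) : ℤ) • Q = d₁.derivedPoint) →
      (¬ ∃ Q : (W.baseChange (ringClassField K ι 1)).toAffine.Point, ((2 ^ (M₀ + 1) : ℕ) : ℤ) • Q = d₁.derivedPoint) →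
      1 ≤ M₀ →
      ∀ (Wd : WeierstrassCurve ℚ) [Wd.IsElliptic] [Wd.IsGloballyMinimal],
      (∃ C : WeierstrassCurve.VariableChange ℚ, C • W.quadraticTwist (NumberField.discr K : ℚ) = Wd) →
      Wd.analyticRank = 1 → Nat.card (Wd.selmerGroup 2) = 2 → padicValNat 2 Wd.tamagawaProduct ≤ 1 →
      ∃ (n : ℕ) (d : KolyvaginHeegnerData Dt β ι n), Squarefree n ∧
      (∀ ℓ ∈ n.primeFactors, Zhang2014.IsKolyvaginPrime (W.conductorNorm ℤ) W K 2 ℓ ∧ 2 ≤ Zhang2014.kolyvaginIndex W 2 ℓ ∧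
      FrobEqFrobInfty W K 2 ℓ) ∧
      ¬ ∃ Q : (W.baseChange (ringClassField K ι n)).toAffine.Point, (2 : ℤ) • Q = d.derivedPoint) :
    GenusDeepSupplyAtTwoNegDiscNarrow :=
  genusDeepSupplyAtTwoNegDiscNarrow_of_items_of_stubC_prime hGZ hmod hpar hconv hconv' (stubC_prime_of_selmerSplit hK1 hK4)

end Summit.BirchSwinnertonDyer.BirchSwinnertonDyer.Theorems.GenusSupplyNarrow.PrimeFrame

end
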